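import Summits.HodgeConjecture.HodgeConjecture.Theorems.Ring2HypothesesFlatSectionsLocalization
import Literature.AlgebraicGeometry.Motives.CurveThroughTwoPoints
import HarnessLib

/-!
# Ring 2 — hypotheses layer: the flat-section node on the printed carriers covers all locally projective families; reduction to curve bases

HONEST FRAMING: research route conditional on HC_CM; not a corollary; Q11.4-sentence-2 already refuted in dim ≥ 3.

Cell `pub-hodge-ring2`, seat `ring2-b04` (binder prover for row b04 of `BINDER-OWNERS.md`:
`Ring2.Hypotheses.FlatSectionsAlgebraic`). Sequel to `Ring2HypothesesFlatSectionsLocalization` (the flat-section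
form of Charles–Schnell Conj. 11.3.1 is LOCAL ON THE BASE). `HC_CM` does not occur; nothing here proves a case of
the Hodge conjecture; no definition, no named fact.

## What this part adds

* `flatSection_algebraic_of_flatSectionsAlgebraicQP_of_locallyQuasiProjective`, `…_of_projective`,
  `flatSection_algebraic_of_variationalHodgeQP_of_projective` — **the printed-carrier node `FlatSectionsAlgebraicQP`
  of part XXVII (equivalently `VariationalHodgeQP`) already gives the flat-section form for every smooth projective
  family locally carried by quasi-projective schemes — in particular every family PROJECTIVE in Hartshorne's sense —
  over ANY smooth irreducible base**: the base-quasi-projectivity clause of part XXVII is idle (compare seat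
  ring2-b03's junction `Ring2.Binders.variationalHodge_quasiProjective_of_variationalHodgeQP` for the global-class
  form on quasi-projective total spaces, and ring2-b01's `flatSection_algebraic_of_flatSectionsAlgebraicQP_of_isQuasiProjectiveOver`).
* `flatSection_algebraic_of_curveBase_of_isAffine`, `flatSectionsAlgebraic_of_curveBase` — **the flat-section node
  reduces to smooth irreducible affine CURVE bases**, granted the named fact
  `Motives.mumford_smoothCurve_through_two_points` (Mumford's lemma + normalisation): local on the base, then inside
  an affine irreducible piece join anchor and target by a smooth affine curve and transport the instance along the
  base change (`flatSection_step_of_baseChange` — pull-back of the flat section along an ARBITRARY morphism of bases,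
  `Literature/…/DirectImageBaseChangeSections`). Flat-section twin of route AnchorTransport's
  `Theorems.variationalHodge_of_curveBase` for the global-class form (item 1076).

Sources. [CharlesSchnell2014Notes] Conj. 11.3.1, Prop. 11.3.5; [MumfordAV1970] §6 Lemma; [Hartshorne1977] II §4;
[VoisinHodgeII2003] §3.1.1.
-/

-- every declaration of this problem lives in `Summit.HodgeConjecture.HodgeConjecture.…` (summit = sub-problem)
set_option linter.dupNamespace false

noncomputable section

open CategoryTheory AlgebraicGeometry MonoidalCategory
open Literature.AlgebraicGeometry Literature.AlgebraicGeometry.Motives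
open Literature.AlgebraicGeometry.HodgeTheory

namespace Summit.HodgeConjecture.HodgeConjecture.Ring2.Hypotheses

/-! ## §1 The printed-carrier node already suffices: `FlatSectionsAlgebraicQP ⟹` the flat-section form for locally quasi-projective families over ANY base -/

section QPNode

variable {n : ℕ} {𝒳 S : SchemeOver ℂ} (f : 𝒳 ⟶ S)

/-- **The base clause of part XXVII is idle for locally quasi-projective families**: the printed-carrier
node `FlatSectionsAlgebraicQP` (Conj. 11.3.1 on quasi-projective `𝒳`, `S`) already gives the
flat-section form for every smooth projective family which is, locally on the base, carried by
quasi-projective schemes — over ANY smooth irreducible base (`flatSection_algebraic_of_local`, each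
restricted family being an instance of the node). Sharpens `flatSection_algebraic_of_vhc_of_locallyQuasiProjective`
(hypothesis `VHC` ⟹ `FlatSectionsAlgebraicQP`, part XXVII). [cite: CharlesSchnell2014Notes, Conj. 11.3.1] -/
theorem flatSection_algebraic_of_flatSectionsAlgebraicQP_of_locallyQuasiProjective (hF : FlatSectionsAlgebraicQP)
    (hf : IsSmoothProjectiveFamily f n) [IrreducibleSpace S.left] [AlgebraicGeometry.Smooth S.hom]
    (hloc : ∀ x : S.left, ∃ U : S.left.Opens, x ∈ U ∧ IsQuasiProjectiveOver (openSubschemeOver S U) ∧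
      IsQuasiProjectiveOver (familyPullback f (openSubschemeOverι S U)))
    (p : ℕ) {σ : ComplexPoints S → FiberClass f (2 * p)} (hσ : Continuous σ) (hpt : ∀ s, (σ s).pt = s)
    (hH : ∀ s, σ s ∈ locusOfHodgeClasses f n p)
    (h₀ : ∃ s₀, (σ s₀).cls ∈ algebraicClasses (fiberOver f (σ s₀).pt) p) (s : ComplexPoints S) :
    (σ s).cls ∈ algebraicClasses (fiberOver f (σ s).pt) p := by
  choose 𝒰 h𝒰 hU𝒰 hX𝒰 using hloc
  refine flatSection_algebraic_of_local f hf 𝒰 h𝒰 (fun x τ hτ hptτ hHτ h₀τ u => ?_) hσ hpt hH h₀ s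
  haveI : IsOpenImmersion (openSubschemeOverι S (𝒰 x)).left := inferInstanceAs (IsOpenImmersion (𝒰 x).ι)
  have hsm : AlgebraicGeometry.Smooth (openSubschemeOver S (𝒰 x)).hom := by
    change AlgebraicGeometry.Smooth ((𝒰 x).ι ≫ S.hom)
    infer_instance
  exact hF (familyPullback.snd f (openSubschemeOverι S (𝒰 x))) (hf.familyPullback_snd _) (hX𝒰 x) (hU𝒰 x)
    (irreducibleSpace_openSubschemeOver (𝒰 x) (h𝒰 x)) hsm p τ hτ hptτ hHτ h₀τ u

/-- **`FlatSectionsAlgebraicQP ⟹` the flat-section form for every family PROJECTIVE in Hartshorne's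
sense over ANY smooth irreducible base** — the printed conjecture's "smooth projective morphism over a
smooth connected base" with NO quasi-projectivity of the base: affine opens are quasi-projective and
relative projectivity restricts (`Motives.exists_isClosedImmersion_familyPullback`,
`Theorems.isQuasiProjectiveOver_of_isClosedImmersion_of_isAffine`). [cite: CharlesSchnell2014Notes, Conj. 11.3.1]
[cite: Hartshorne1977, Ch. II §4 p. 103] -/
theorem flatSection_algebraic_of_flatSectionsAlgebraicQP_of_projective (hF : FlatSectionsAlgebraicQP)
    (hf : IsSmoothProjectiveFamily f n) [IrreducibleSpace S.left] [AlgebraicGeometry.Smooth S.hom]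
    (hι : ∃ (N : ℕ) (ι : 𝒳 ⟶ projectiveSpace N ℂ ⊗ S), IsClosedImmersion ι.left ∧
      ι ≫ CartesianMonoidalCategory.snd (projectiveSpace N ℂ) S = f)
    (p : ℕ) {σ : ComplexPoints S → FiberClass f (2 * p)} (hσ : Continuous σ) (hpt : ∀ s, (σ s).pt = s)
    (hH : ∀ s, σ s ∈ locusOfHodgeClasses f n p)
    (h₀ : ∃ s₀, (σ s₀).cls ∈ algebraicClasses (fiberOver f (σ s₀).pt) p) (s : ComplexPoints S) :
    (σ s).cls ∈ algebraicClasses (fiberOver f (σ s).pt) p := by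
  refine flatSection_algebraic_of_flatSectionsAlgebraicQP_of_locallyQuasiProjective f hF hf (fun x => ?_) p
    hσ hpt hH h₀ s
  obtain ⟨U, hU, hxU, -⟩ := exists_isAffineOpen_mem_and_subset (U := ⊤) (x := x) trivial
  haveI : IsOpenImmersion (openSubschemeOverι S U).left := inferInstanceAs (IsOpenImmersion U.ι)
  haveI : IsAffine (openSubschemeOver S U).left := hU
  haveI : AlgebraicGeometry.Smooth (openSubschemeOver S U).hom := by
    change AlgebraicGeometry.Smooth (U.ι ≫ S.hom)
    infer_instance
  haveI : LocallyOfFiniteType (openSubschemeOver S U).hom := inferInstance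
  exact ⟨U, hxU, IsQuasiProjectiveOver.of_isAffine _,
    Theorems.isQuasiProjectiveOver_of_isClosedImmersion_of_isAffine
      (f := familyPullback.snd f (openSubschemeOverι S U))
      (exists_isClosedImmersion_familyPullback f (openSubschemeOverι S U) hι)⟩

/-- The same from the global-class node on the printed carriers (`VariationalHodgeQP`, part XXVII's
`flatSectionsAlgebraicQP_iff_variationalHodgeQP`). [cite: CharlesSchnell2014Notes, Conj. 11.3.1 and proof of Prop. 11.3.5] -/
theorem flatSection_algebraic_of_variationalHodgeQP_of_projective (hV : VariationalHodgeQP)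
    (hf : IsSmoothProjectiveFamily f n) [IrreducibleSpace S.left] [AlgebraicGeometry.Smooth S.hom]
    (hι : ∃ (N : ℕ) (ι : 𝒳 ⟶ projectiveSpace N ℂ ⊗ S), IsClosedImmersion ι.left ∧
      ι ≫ CartesianMonoidalCategory.snd (projectiveSpace N ℂ) S = f)
    (p : ℕ) {σ : ComplexPoints S → FiberClass f (2 * p)} (hσ : Continuous σ) (hpt : ∀ s, (σ s).pt = s)
    (hH : ∀ s, σ s ∈ locusOfHodgeClasses f n p)
    (h₀ : ∃ s₀, (σ s₀).cls ∈ algebraicClasses (fiberOver f (σ s₀).pt) p) (s : ComplexPoints S) :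
    (σ s).cls ∈ algebraicClasses (fiberOver f (σ s).pt) p :=
  flatSection_algebraic_of_flatSectionsAlgebraicQP_of_projective f
    (flatSectionsAlgebraicQP_iff_variationalHodgeQP.2 hV) hf hι p hσ hpt hH h₀ s

end QPNode

/-! ## §2 Reduction of the flat-section node to CURVE bases (granted Mumford's lemma) -/

section CurveBase

variable {n : ℕ} {𝒳 S : SchemeOver ℂ} (f : 𝒳 ⟶ S)

/-- **Inside an affine irreducible base, the flat-section statement over smooth affine CURVES suffices**
(granted the named fact `Motives.mumford_smoothCurve_through_two_points`, Mumford's lemma + normalisation):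
join the anchor `s₀` to the target `s` by a smooth irreducible affine curve `g : C ⟶ S` and transport the
instance along the base change (`flatSection_step_of_baseChange`; the base-changed family over `C` is a
smooth projective family over a smooth irreducible affine curve, `IsSmoothProjectiveFamily.familyPullback_snd`).
Flat-section twin of `Theorems.variationalHodge_of_curveBase_of_stable`. [cite: MumfordAV1970, §6, Lemma]
[cite: CharlesSchnell2014Notes, Conj. 11.3.1] -/
theorem flatSection_algebraic_of_curveBase_of_isAffine (hC : mumford_smoothCurve_through_two_points)
    (h : ∀ ⦃n : ℕ⦄ ⦃𝒳 S : SchemeOver ℂ⦄ (f : 𝒳 ⟶ S), IsSmoothProjectiveFamily f n →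
      IrreducibleSpace S.left → IsAffine S.left → AlgebraicGeometry.Smooth S.hom →
      topologicalKrullDim S.left = 1 →
      ∀ (p : ℕ) (σ : ComplexPoints S → FiberClass f (2 * p)),
      Continuous σ → (∀ s, (σ s).pt = s) → (∀ s, σ s ∈ locusOfHodgeClasses f n p) →
      (∃ s₀, (σ s₀).cls ∈ algebraicClasses (fiberOver f (σ s₀).pt) p) →
      ∀ s, (σ s).cls ∈ algebraicClasses (fiberOver f (σ s).pt) p)
    (hf : IsSmoothProjectiveFamily f n) [IrreducibleSpace S.left] [IsAffine S.left]
    [AlgebraicGeometry.Smooth S.hom]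
    (p : ℕ) {σ : ComplexPoints S → FiberClass f (2 * p)} (hσ : Continuous σ) (hpt : ∀ s, (σ s).pt = s)
    (hH : ∀ s, σ s ∈ locusOfHodgeClasses f n p)
    (h₀ : ∃ s₀, (σ s₀).cls ∈ algebraicClasses (fiberOver f (σ s₀).pt) p) (s : ComplexPoints S) :
    (σ s).cls ∈ algebraicClasses (fiberOver f (σ s).pt) p := by
  obtain ⟨s₀, hs₀⟩ := h₀
  by_cases hss : s₀ = s
  · subst hss
    exact hs₀
  haveI : LocallyOfFiniteType S.hom := inferInstance
  obtain ⟨C, g, a', b', hCaff, hCirr, hCsm, hCdim, ha', hb'⟩ :=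
    mumford_smoothCurve_through_two_points.of_irreducibleSpace hC s₀ s hss
  have h₀' : (σ (AlgPoints.map g a')).cls ∈ algebraicClasses (fiberOver f (σ (AlgPoints.map g a')).pt) p := by
    rw [ha']
    exact hs₀
  have key := flatSection_step_of_baseChange f g hf hσ hpt hH
    (fun τ hτ hptτ hHτ h₀τ u => h (familyPullback.snd f g) (hf.familyPullback_snd g) hCirr hCaff hCsm hCdim
      p τ hτ hptτ hHτ h₀τ u) h₀' b'
  rwa [hb'] at key

/-- **The flat-section node reduces to smooth irreducible affine CURVE bases** (granted Mumford's lemma):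
if the flat-section form of Conj. 11.3.1 holds for smooth projective families over smooth irreducible
affine `ℂ`-schemes of topological Krull dimension `1`, it holds over every smooth irreducible base —
local on the base (`flatSection_algebraic_of_local` with an affine cover), then curves inside each
affine piece (`flatSection_algebraic_of_curveBase_of_isAffine`). Flat-section twin of
`Theorems.variationalHodge_of_curveBase`. [cite: MumfordAV1970, §6, Lemma] [cite: CharlesSchnell2014Notes, Conj. 11.3.1] -/
theorem flatSectionsAlgebraic_of_curveBase (hC : mumford_smoothCurve_through_two_points)
    (h : ∀ ⦃n : ℕ⦄ ⦃𝒳 S : SchemeOver ℂ⦄ (f : 𝒳 ⟶ S), IsSmoothProjectiveFamily f n →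
      IrreducibleSpace S.left → IsAffine S.left → AlgebraicGeometry.Smooth S.hom →
      topologicalKrullDim S.left = 1 →
      ∀ (p : ℕ) (σ : ComplexPoints S → FiberClass f (2 * p)),
      Continuous σ → (∀ s, (σ s).pt = s) → (∀ s, σ s ∈ locusOfHodgeClasses f n p) →
      (∃ s₀, (σ s₀).cls ∈ algebraicClasses (fiberOver f (σ s₀).pt) p) →
      ∀ s, (σ s).cls ∈ algebraicClasses (fiberOver f (σ s).pt) p) :
    FlatSectionsAlgebraic := by
  intro n 𝒳 S f hf hirr hsm p σ hσ hpt hH h₀ s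
  haveI := hirr
  haveI := hsm
  -- an affine open cover of `S`
  have hcov : ∀ x : S.left, ∃ U : S.left.Opens, x ∈ U ∧ IsAffineOpen U := fun x => by
    obtain ⟨U, hU, hxU, -⟩ := exists_isAffineOpen_mem_and_subset (U := ⊤) (x := x) trivial
    exact ⟨U, hxU, hU⟩
  choose 𝒰 h𝒰 hA𝒰 using hcov
  refine flatSection_algebraic_of_local f hf 𝒰 h𝒰 (fun x τ hτ hptτ hHτ h₀τ u => ?_) hσ hpt hH h₀ s
  haveI : IsOpenImmersion (openSubschemeOverι S (𝒰 x)).left := inferInstanceAs (IsOpenImmersion (𝒰 x).ι)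
  haveI : IsAffine (openSubschemeOver S (𝒰 x)).left := hA𝒰 x
  haveI : AlgebraicGeometry.Smooth (openSubschemeOver S (𝒰 x)).hom := by
    change AlgebraicGeometry.Smooth ((𝒰 x).ι ≫ S.hom)
    infer_instance
  haveI := irreducibleSpace_openSubschemeOver (S := S) (𝒰 x) (h𝒰 x)
  exact flatSection_algebraic_of_curveBase_of_isAffine (familyPullback.snd f (openSubschemeOverι S (𝒰 x))) hC h
    (hf.familyPullback_snd _) p hτ hptτ hHτ h₀τ u

end CurveBase

/-! ## Audit

No definition, no named fact, no `sorry`; `HC_CM` does not occur. `flatSectionsAlgebraic_of_curveBase` concludes the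
row's decl under the displayed hypotheses `hC` (Mumford's lemma, a Literature named fact) and `h` (the curve-base
statement) — a REDUCTION, crediting nothing. Axiom closures: the three standard axioms only. -/

#print axioms Summit.HodgeConjecture.HodgeConjecture.Ring2.Hypotheses.flatSection_algebraic_of_flatSectionsAlgebraicQP_of_projective
#print axioms Summit.HodgeConjecture.HodgeConjecture.Ring2.Hypotheses.flatSectionsAlgebraic_of_curveBase

end Summit.HodgeConjecture.HodgeConjecture.Ring2.Hypotheses

end
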